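import Literature.Analysis.FluidPDE.LocalLerayLimitingProcedure
import Literature.Analysis.FluidPDE.NSCylinderVelocityCompactness
import Literature.Analysis.FluidPDE.CylinderTenThirds
import Literature.Analysis.FluidPDE.WeakGradientSubseqLimit
import Literature.Analysis.FluidPDE.SuitableWeakExhaustion
import Literature.Analysis.FluidPDE.SuitableWeakRescaling
import Literature.Analysis.FunctionSpaces.WeakCompactnessLpFinite
import Literature.Analysis.FunctionSpaces.LpInterpolationConvergence
import Literature.Analysis.FunctionSpaces.DiagonalSubsequence
import HarnessLib

/-!
# Proof of Rusin–Šverák's Prop. 2.2 (`rusin_sverak_2011_proposition_2_2_holds`):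
compactness of suitable weak solutions on an arbitrary open space–time set

Analysis/FluidPDE proofs file (no definitions, no named facts) **discharging the named fact**
`Literature.Analysis.FluidPDE.rusin_sverak_2011_proposition_2_2`
(`LocalLerayLimitingProcedure.lean`; Rusin–Šverák, J. Funct. Anal. 260 (2011) =
arXiv:0911.0500, **Prop. 2.2** p. 4 = Jia–Šverák 2013, Lemma 5; the printed sources refer to
Caffarelli–Kohn–Nirenberg 1982, Lin 1998 (Thm. 2.2), Scheffer and Ladyzhenskaya–Seregin 1999
for the proof): suitable weak solutions `(u^k, p^k)` on an open `O ⊆ ℝ × ℝ³`, bounded in the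
energy space and with pressures bounded in `L^{3/2}` on compact subsets of `O`, converge along a
subsequence — `u^k → u` in `L³_loc(O)`, `p^k ⇀ p` weakly in `L^{3/2}_loc(O)` — to a suitable weak
solution `(u, p)` on `O`.

## The proof

All the analysis is in accepted files of the tree (it is the localisation to an arbitrary open
set of the cylinder statement `bradshawTsai2019_cylinderCompactness_holds`, Lin 1998, Thm. 2.2);
this file is the covering / extraction / gluing bookkeeping.

1. *A countable cover by double balls* (`exists_seq_double_ball_cover`): `O = ⋃ᵢ B(cᵢ, rᵢ)` with
   `B̄(cᵢ, 2rᵢ) ⊆ O`; for the sup metric of `ℝ × ℝ³` these balls are the cylinders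
   `(tᵢ - ρ, tᵢ + ρ) × B(xᵢ, ρ)`, on which the hypotheses of Prop. 2.2 give the uniform bounds of
   the cylinder theory (`exists_cylinder_bounds`).
2. *Velocities* (`exists_strictMono_velocity_limit`): on every outer cylinder the tree's
   Aubin–Lions theorem `NSCylinder.exists_subseq_strong_limit_velocity_ball`; Cantor's diagonal
   procedure over the cylinders (`FunctionSpaces.exists_strictMono_forall_of_extraction`, with
   a.e. convergence built into the extracted property), the limit being the pointwise limit
   where it exists — so that no gluing is needed.
3. *`L^{10/3}` and `L³`* on the finite unions `Sₙ = ⋃_{i ≤ n} B(cᵢ, rᵢ)` (an exhaustion of `O`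
   by open sets of compact closure): `exists_forall_setLIntegral_tenThirds_le_of_isCompact` on
   the compact `B̄(cᵢ, rᵢ) ⊆ B(cᵢ, 2rᵢ)`, Fatou for the limit, and the interpolation
   `L² ∩ L^{10/3} ⊂ L³` (`FunctionSpaces.tendsto_eLpNorm_three_of_sq_of_tenThirds`).
4. *Pressures and gradients* on every `Sₙ` (second diagonal procedure): weak compactness in
   `L^{3/2}(Sₙ)` (`FunctionSpaces.exists_subseq_tendsto_integral_mul_of_lintegral_rpow_le'`,
   Dunford–Pettis) and weak `L²(Sₙ)` limits of the weak gradients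
   (`exists_subseq_weakGradient_weakLimit`); the pressures are glued along the exhaustion
   (`FunctionSpaces.exists_glue_of_ae_eq`, weak limits being a.e. unique).
5. *Suitability of the limit* on every `Sₙ` (`isSuitableWeakSolutionOn_of_tendsto`: the
   equations pass to the limit, the right-hand side of the local energy inequality converges,
   its left-hand side is lower semicontinuous) and on `O` by exhaustion
   (`IsSuitableWeakSolutionOn.of_exhaustion`).

## References

* W. Rusin, V. Šverák, *Minimal initial data for potential Navier–Stokes singularities*,
  J. Funct. Anal. 260 (2011) 879–891 = arXiv:0911.0500, §2, Prop. 2.2 (p. 4). [RusinSverak2011]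
* H. Jia, V. Šverák, SIAM J. Math. Anal. 45 (2013) = arXiv:1201.1592, Lemma 5. [JiaSverak2013]
* F. Lin, *A new proof of the Caffarelli–Kohn–Nirenberg theorem*, CPAM 51 (1998), Thm. 2.2.
  [Lin1998]
* L. Caffarelli, R. Kohn, L. Nirenberg, CPAM 35 (1982), §2 and Appendix.
  [CaffarelliKohnNirenberg1982]
-/

noncomputable section

open MeasureTheory TopologicalSpace Set Function Filter Metric
open _root_.Topology
open scoped ENNReal NNReal RealInnerProductSpace

namespace Literature.Analysis.FluidPDE

/-! ### Step 1: a countable cover by double balls, and the cylinder bounds -/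

section Cover

/-- **A countable cover of a nonempty open set by balls whose concentric doubles stay inside**
(Lindelöf): in a separable metric space, a nonempty open `O` is `⋃ᵢ B(cᵢ, rᵢ)` with `rᵢ > 0` and
`B̄(cᵢ, 2rᵢ) ⊆ O` (centres in a countable dense set, radii `1/(m+1)`). [folklore] -/
theorem exists_seq_double_ball_cover {X : Type*} [MetricSpace X] [SeparableSpace X] {O : Set X}
    (hO : IsOpen O) (hne : O.Nonempty) :
    ∃ (c : ℕ → X) (r : ℕ → ℝ), (∀ i, 0 < r i) ∧ (∀ i, closedBall (c i) (2 * r i) ⊆ O) ∧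
      ∀ z ∈ O, ∃ i, z ∈ ball (c i) (r i) := by
  haveI : Nonempty X := ⟨hne.some⟩
  obtain ⟨d, hd⟩ := TopologicalSpace.exists_dense_seq X
  set A : Set (ℕ × ℕ) := {q | closedBall (d q.1) (2 * (1 / ((q.2 : ℝ) + 1))) ⊆ O} with hA
  -- every point of `O` is in an admissible ball
  have hcov : ∀ z ∈ O, ∃ q ∈ A, z ∈ ball (d q.1) (1 / ((q.2 : ℝ) + 1)) := by
    intro z hz
    obtain ⟨ε, hε, hεO⟩ := Metric.isOpen_iff.1 hO z hz
    obtain ⟨m, hm⟩ := exists_nat_one_div_lt (K := ℝ) (ε := ε / 4) (by positivity)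
    have hr0 : (0 : ℝ) < 1 / ((m : ℝ) + 1) := by positivity
    obtain ⟨k, hk⟩ := hd.exists_dist_lt z hr0
    refine ⟨(k, m), ?_, ?_⟩
    · intro y hy
      refine hεO ?_
      rw [mem_closedBall] at hy
      rw [mem_ball]
      calc dist y z ≤ dist y (d k) + dist (d k) z := dist_triangle _ _ _
        _ ≤ 2 * (1 / ((m : ℝ) + 1)) + 1 / ((m : ℝ) + 1) := by
            rw [dist_comm (d k) z]; exact add_le_add hy hk.le
        _ < ε := by linarith
    · rw [mem_ball]; exact hk
  have hAne : A.Nonempty := by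
    obtain ⟨q, hq, -⟩ := hcov _ hne.some_mem
    exact ⟨q, hq⟩
  obtain ⟨e, he⟩ := (Set.to_countable A).exists_eq_range hAne
  refine ⟨fun i => d (e i).1, fun i => 1 / (((e i).2 : ℝ) + 1), fun i => by positivity,
    fun i => ?_, fun z hz => ?_⟩
  · have h : e i ∈ A := by rw [he]; exact mem_range_self i
    exact h
  · obtain ⟨q, hq, hzq⟩ := hcov z hz
    rw [he] at hq
    obtain ⟨i, rfl⟩ := hq
    exact ⟨i, hzq⟩

/-- A ball of the sup metric of `ℝ × E` is the cylinder `(t - ρ, t + ρ) × B(x, ρ)`. [folklore] -/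
theorem Ioo_prod_ball_eq_ball {E : Type*} [PseudoMetricSpace E] (z : ℝ × E) (ρ : ℝ) :
    Ioo (z.1 - ρ) (z.1 + ρ) ×ˢ ball z.2 ρ = ball z ρ := by
  rw [← Real.ball_eq_Ioo, ball_prod_same]

variable {O : Opens (ℝ × EuclideanSpace ℝ (Fin 3))}
  {useq : ℕ → ℝ → EuclideanSpace ℝ (Fin 3) → EuclideanSpace ℝ (Fin 3)}
  {pseq : ℕ → ℝ → EuclideanSpace ℝ (Fin 3) → ℝ}
  {G : ℕ → ℝ → EuclideanSpace ℝ (Fin 3) → EuclideanSpace ℝ (Fin 3) →L[ℝ] EuclideanSpace ℝ (Fin 3)}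

/-- **The cylinder bounds.** On a cylinder `W = (t₀ - ρ, t₀ + ρ) × B(x₀, ρ)` with
`W̄ ⊆ O`, the hypotheses of Prop. 2.2 (suitable weak solutions with uniform energy, gradient and
pressure bounds on compact subsets of `O`) give one constant `C` with, for every `k`:
`∫_{B} |u^k(t)|² ≤ C` for a.e. `t ∈ (t₀ - ρ, t₀ + ρ)`, `∬_W |∇u^k|² ≤ C`, `∬_W |p^k|^{3/2} ≤ C`;
and the `(u^k, p^k)` are distributional solutions with weak gradients `G_k` on `W`. [folklore] -/
theorem exists_cylinder_bounds
    (hsuit : ∀ k, IsSuitableWeakSolutionOn O 1 0 (useq k) (pseq k))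
    (hE : ∀ K ⊆ (O : Set (ℝ × EuclideanSpace ℝ (Fin 3))), IsCompact K → ∃ C : ℝ≥0, ∀ k,
      ∀ᵐ t : ℝ,
      ∫⁻ x, K.indicator (fun z : ℝ × (EuclideanSpace ℝ (Fin 3)) => ‖useq k z.1 z.2‖ₑ ^ 2) (t, x) ≤ C)
    (hGw : ∀ k, HasWeakSpatialGradientOn O (useq k) (G k))
    (hGb : ∀ K ⊆ (O : Set (ℝ × (EuclideanSpace ℝ (Fin 3)))), IsCompact K → ∃ C : ℝ≥0, ∀ k,
      ∫⁻ z in K, ENNReal.ofReal (frobeniusNormSq (G k z.1 z.2)) ≤ C)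
    (hP : ∀ K ⊆ (O : Set (ℝ × (EuclideanSpace ℝ (Fin 3)))), IsCompact K → ∃ C : ℝ≥0, ∀ k,
      ∫⁻ z in K, ‖pseq k z.1 z.2‖ₑ ^ (3 / 2 : ℝ) ≤ C)
    (z₀ : ℝ × EuclideanSpace ℝ (Fin 3)) {ρ : ℝ}
    (hρO : closedBall z₀ ρ ⊆ (O : Set (ℝ × EuclideanSpace ℝ (Fin 3)))) :
    ∃ C : ℝ≥0,
      (∀ k, ∀ᵐ t ∂((volume : Measure ℝ).restrict (Ioo (z₀.1 - ρ) (z₀.1 + ρ))),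
        ∫⁻ x in ball z₀.2 ρ, ‖useq k t x‖ₑ ^ 2 ≤ C) ∧
      (∀ k, ∫⁻ z in Ioo (z₀.1 - ρ) (z₀.1 + ρ) ×ˢ ball z₀.2 ρ,
        ENNReal.ofReal (frobeniusNormSq (G k z.1 z.2)) ≤ C) ∧
      (∀ k, ∫⁻ z in Ioo (z₀.1 - ρ) (z₀.1 + ρ) ×ˢ ball z₀.2 ρ,
        ‖pseq k z.1 z.2‖ₑ ^ (3 / 2 : ℝ) ≤ C) ∧
      (∀ k, IsDistributionalNSSolutionOn
        (timeCylinder (⟨ball z₀.2 ρ, isOpen_ball⟩ : Opens (EuclideanSpace ℝ (Fin 3))) (z₀.1 - ρ)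
          (z₀.1 + ρ)) 1 0 (useq k) (pseq k)) ∧
      ∀ k, HasWeakSpatialGradientOn
        (timeCylinder (⟨ball z₀.2 ρ, isOpen_ball⟩ : Opens (EuclideanSpace ℝ (Fin 3))) (z₀.1 - ρ)
          (z₀.1 + ρ)) (useq k) (G k) := by
  set W : Set (ℝ × (EuclideanSpace ℝ (Fin 3))) := Ioo (z₀.1 - ρ) (z₀.1 + ρ) ×ˢ ball z₀.2 ρ with hW
  have hWb : W = ball z₀ ρ := Ioo_prod_ball_eq_ball z₀ ρ
  set K : Set (ℝ × (EuclideanSpace ℝ (Fin 3))) := closedBall z₀ ρ with hK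
  have hKc : IsCompact K := isCompact_closedBall _ _
  have hWK : W ⊆ K := by rw [hWb]; exact ball_subset_closedBall
  have hWO : W ⊆ (O : Set (ℝ × (EuclideanSpace ℝ (Fin 3)))) := hWK.trans hρO
  have hle : (timeCylinder (⟨ball z₀.2 ρ, isOpen_ball⟩ : Opens (EuclideanSpace ℝ (Fin 3)))
      (z₀.1 - ρ) (z₀.1 + ρ)) ≤ O :=
    fun z hz => hWO hz
  obtain ⟨C₁, hC₁⟩ := hE K hρO hKc
  obtain ⟨C₂, hC₂⟩ := hGb K hρO hKc
  obtain ⟨C₃, hC₃⟩ := hP K hρO hKc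
  refine ⟨max C₁ (max C₂ C₃), fun k => ?_, fun k => ?_, fun k => ?_,
    fun k => (hsuit k).distributional.of_le hle, fun k => (hGw k).mono hle⟩
  · rw [ae_restrict_iff' measurableSet_Ioo]
    filter_upwards [hC₁ k] with t ht htI
    calc ∫⁻ x in ball z₀.2 ρ, ‖useq k t x‖ₑ ^ 2
        = ∫⁻ x, (ball z₀.2 ρ).indicator (fun x => ‖useq k t x‖ₑ ^ 2) x :=
          (lintegral_indicator measurableSet_ball _).symm
      _ ≤ ∫⁻ x, K.indicator (fun z : ℝ × EuclideanSpace ℝ (Fin 3) => ‖useq k z.1 z.2‖ₑ ^ 2)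
            (t, x) := by
          refine lintegral_mono fun x => ?_
          by_cases hx : x ∈ ball z₀.2 ρ
          · have hz : (t, x) ∈ K := hWK (mk_mem_prod htI hx)
            rw [indicator_of_mem hx, indicator_of_mem hz]
          · rw [indicator_of_notMem hx]
            exact zero_le
      _ ≤ C₁ := ht
      _ ≤ (max C₁ (max C₂ C₃) : ℝ≥0) := by exact_mod_cast le_max_left _ _
  · calc ∫⁻ z in W, ENNReal.ofReal (frobeniusNormSq (G k z.1 z.2))
        ≤ ∫⁻ z in K, ENNReal.ofReal (frobeniusNormSq (G k z.1 z.2)) := lintegral_mono_set hWK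
      _ ≤ C₂ := hC₂ k
      _ ≤ (max C₁ (max C₂ C₃) : ℝ≥0) := by
          exact_mod_cast (le_max_left _ _).trans (le_max_right _ _)
  · calc ∫⁻ z in W, ‖pseq k z.1 z.2‖ₑ ^ (3 / 2 : ℝ)
        ≤ ∫⁻ z in K, ‖pseq k z.1 z.2‖ₑ ^ (3 / 2 : ℝ) := lintegral_mono_set hWK
      _ ≤ C₃ := hC₃ k
      _ ≤ (max C₁ (max C₂ C₃) : ℝ≥0) := by
          exact_mod_cast (le_max_right _ _).trans (le_max_right _ _)

end Cover

/-! ### Step 2: the velocities (Aubin–Lions on every cylinder, diagonal extraction) -/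

section Velocity

variable {O : Opens (ℝ × EuclideanSpace ℝ (Fin 3))}
  {useq : ℕ → ℝ → EuclideanSpace ℝ (Fin 3) → EuclideanSpace ℝ (Fin 3)}
  {pseq : ℕ → ℝ → EuclideanSpace ℝ (Fin 3) → ℝ}
  {G : ℕ → ℝ → EuclideanSpace ℝ (Fin 3) → EuclideanSpace ℝ (Fin 3) →L[ℝ] EuclideanSpace ℝ (Fin 3)}

set_option maxHeartbeats 800000 in
/-- **Strong `L²` compactness of the velocities on a sequence of cylinders, one subsequence and
one limit for all of them.** Under the hypotheses of Prop. 2.2, for cylinders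
`Wᵢ = (tᵢ - ρᵢ, tᵢ + ρᵢ) × B(xᵢ, ρᵢ)` with `W̄ᵢ ⊆ O` there are a strictly increasing `φ` and a field
`u` such that on every `Wᵢ`: `u` is measurable, its slices obey the uniform energy bound of the
`u^k`, and `u^{φ(k)} → u` in `L²(Wᵢ)` (Lin 1998, Thm. 2.2; the tree's Aubin–Lions theorem
`NSCylinder.exists_subseq_strong_limit_velocity_ball` on each cylinder, Cantor's diagonal
procedure with a.e. convergence carried along, and the pointwise limit as the common limit).
[cite: Lin1998, Thm. 2.2] -/
theorem exists_strictMono_velocity_limit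
    (hsuit : ∀ k, IsSuitableWeakSolutionOn O 1 0 (useq k) (pseq k))
    (hE : ∀ K ⊆ (O : Set (ℝ × EuclideanSpace ℝ (Fin 3))), IsCompact K → ∃ C : ℝ≥0, ∀ k,
      ∀ᵐ t : ℝ,
      ∫⁻ x, K.indicator (fun z : ℝ × (EuclideanSpace ℝ (Fin 3)) => ‖useq k z.1 z.2‖ₑ ^ 2) (t, x) ≤ C)
    (hGw : ∀ k, HasWeakSpatialGradientOn O (useq k) (G k))
    (hGb : ∀ K ⊆ (O : Set (ℝ × (EuclideanSpace ℝ (Fin 3)))), IsCompact K → ∃ C : ℝ≥0, ∀ k,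
      ∫⁻ z in K, ENNReal.ofReal (frobeniusNormSq (G k z.1 z.2)) ≤ C)
    (hP : ∀ K ⊆ (O : Set (ℝ × (EuclideanSpace ℝ (Fin 3)))), IsCompact K → ∃ C : ℝ≥0, ∀ k,
      ∫⁻ z in K, ‖pseq k z.1 z.2‖ₑ ^ (3 / 2 : ℝ) ≤ C)
    (c : ℕ → ℝ × EuclideanSpace ℝ (Fin 3)) (ρ : ℕ → ℝ)
    (hρO : ∀ i, closedBall (c i) (ρ i) ⊆ (O : Set (ℝ × EuclideanSpace ℝ (Fin 3)))) :
    ∃ (φ : ℕ → ℕ) (u : ℝ → EuclideanSpace ℝ (Fin 3) → EuclideanSpace ℝ (Fin 3)), StrictMono φ ∧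
    ∀ i,
      AEStronglyMeasurable (uncurry u)
        (volume.restrict (Ioo ((c i).1 - ρ i) ((c i).1 + ρ i) ×ˢ ball (c i).2 (ρ i))) ∧
      (∃ C : ℝ≥0,
        (∀ k, ∀ᵐ t ∂((volume : Measure ℝ).restrict (Ioo ((c i).1 - ρ i) ((c i).1 + ρ i))),
          ∫⁻ x in ball (c i).2 (ρ i), ‖useq k t x‖ₑ ^ 2 ≤ C) ∧
        (∀ k, HasWeakSpatialGradientOn
          (timeCylinder (⟨ball (c i).2 (ρ i), isOpen_ball⟩ : Opens (EuclideanSpace ℝ (Fin 3))) ((c i).1 - ρ i)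
            ((c i).1 + ρ i)) (useq k) (G k)) ∧
        (∀ k, ∫⁻ z in Ioo ((c i).1 - ρ i) ((c i).1 + ρ i) ×ˢ ball (c i).2 (ρ i),
          ENNReal.ofReal (frobeniusNormSq (G k z.1 z.2)) ≤ C) ∧
        ∀ᵐ t ∂((volume : Measure ℝ).restrict (Ioo ((c i).1 - ρ i) ((c i).1 + ρ i))),
          ∫⁻ x in ball (c i).2 (ρ i), ‖u t x‖ₑ ^ 2 ≤ C) ∧
      Tendsto (fun k => ∫⁻ z in Ioo ((c i).1 - ρ i) ((c i).1 + ρ i) ×ˢ ball (c i).2 (ρ i),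
        ‖useq (φ k) z.1 z.2 - u z.1 z.2‖ₑ ^ 2) atTop (𝓝 0) := by
  choose C hCE hCG hCP hdist hgradW using
    fun i => exists_cylinder_bounds hsuit hE hGw hGb hP (c i) (hρO i)
  -- the cylinders
  set W : ℕ → Set (ℝ × EuclideanSpace ℝ (Fin 3)) := fun i =>
    Ioo ((c i).1 - ρ i) ((c i).1 + ρ i) ×ˢ ball (c i).2 (ρ i) with hW
  have hWO : ∀ i, W i ⊆ (O : Set (ℝ × (EuclideanSpace ℝ (Fin 3)))) := fun i => by
    rw [hW]
    dsimp only
    rw [Ioo_prod_ball_eq_ball]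
    exact ball_subset_closedBall.trans (hρO i)
  have hvm : ∀ i k, AEStronglyMeasurable (uncurry (useq k)) (volume.restrict (W i)) :=
    fun i k => ((hsuit k).distributional.1.mono_set (hWO i)).aestronglyMeasurable
  -- the extracted property on the `i`-th cylinder
  set P : ℕ → (ℕ → ℕ) → Prop := fun i φ =>
    ∃ w : ℝ → EuclideanSpace ℝ (Fin 3) → EuclideanSpace ℝ (Fin 3),
      AEStronglyMeasurable (uncurry w) (volume.restrict (W i)) ∧
      (∀ᵐ t ∂((volume : Measure ℝ).restrict (Ioo ((c i).1 - ρ i) ((c i).1 + ρ i))),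
        ∫⁻ x in ball (c i).2 (ρ i), ‖w t x‖ₑ ^ 2 ≤ C i) ∧
      Tendsto (fun k => ∫⁻ z in W i, ‖useq (φ k) z.1 z.2 - w z.1 z.2‖ₑ ^ 2) atTop (𝓝 0) ∧
      ∀ᵐ z ∂(volume.restrict (W i)),
        Tendsto (fun k => uncurry (useq (φ k)) z) atTop (𝓝 (uncurry w z)) with hP_def
  have hsub : ∀ i (φ φ' : ℕ → ℕ),
      (∃ τ : ℕ → ℕ, StrictMono τ ∧ ∀ᶠ k in atTop, φ' k = φ (τ k)) → P i φ → P i φ' := by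
    rintro i φ φ' ⟨τ, hτ, heq⟩ ⟨w, hwm, hwE, hws, hwae⟩
    refine ⟨w, hwm, hwE, ?_, ?_⟩
    · exact FunctionSpaces.tendsto_of_eventually_eq_comp
        (a := fun m => ∫⁻ z in W i, ‖useq m z.1 z.2 - w z.1 z.2‖ₑ ^ 2) hτ heq hws
    · filter_upwards [hwae] with z hz
      exact FunctionSpaces.tendsto_of_eventually_eq_comp (a := fun m => uncurry (useq m) z)
        hτ heq hz
  have hex : ∀ i (φ : ℕ → ℕ), StrictMono φ → ∃ ψ : ℕ → ℕ, StrictMono ψ ∧ P i (φ ∘ ψ) := by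
    intro i φ _hφ
    have hCt : ((C i : ℝ≥0) : ℝ≥0∞) ≠ ⊤ := ENNReal.coe_ne_top
    obtain ⟨σ, w, hσ, hwm, hwE, hws, -⟩ :=
      NSCylinder.exists_subseq_strong_limit_velocity_ball (c i).2 (ρ i)
        (a := (c i).1 - ρ i) (b := (c i).1 + ρ i)
        (v := fun k => useq (φ k)) (π := fun k => pseq (φ k)) hCt hCt hCt
        (fun k => hdist i (φ k)) (fun k => hCE i (φ k))
        (fun k => ⟨G (φ k), hgradW i (φ k), hCG i (φ k)⟩) (fun k => hCP i (φ k))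
    -- a.e. convergence along a further subsequence
    have h2 := tendsto_eLpNorm_sub_of_tendsto_lintegral_sub_sq
      (V := fun j => useq (φ (σ j))) (u := w) hws
    have hTIM := tendstoInMeasure_of_tendsto_eLpNorm two_ne_zero
      (fun j => hvm i (φ (σ j))) hwm h2
    obtain ⟨ns, hns, hae⟩ := hTIM.exists_seq_tendsto_ae
    refine ⟨σ ∘ ns, hσ.comp hns, w, hwm, hwE, hws.comp hns.tendsto_atTop, ?_⟩
    filter_upwards [hae] with z hz
    exact hz
  obtain ⟨φ, hφ, hPφ⟩ := FunctionSpaces.exists_strictMono_forall_of_extraction hsub hex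
  -- the common limit: the pointwise limit where it exists
  set u : ℝ → EuclideanSpace ℝ (Fin 3) → EuclideanSpace ℝ (Fin 3) := fun t x =>
    limUnder atTop (fun k => useq (φ k) t x) with hu
  refine ⟨φ, u, hφ, fun i => ?_⟩
  obtain ⟨w, hwm, hwE, hws, hwae⟩ := hPφ i
  have hae : ∀ᵐ z ∂(volume.restrict (W i)), uncurry u z = uncurry w z := by
    filter_upwards [hwae] with z hz
    exact hz.limUnder_eq
  have hae' : ∀ᵐ z ∂(volume.restrict (W i)), uncurry w z = uncurry u z :=
    hae.mono fun z hz => hz.symm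
  refine ⟨hwm.congr hae', ⟨C i, hCE i, hgradW i, hCG i, ?_⟩, ?_⟩
  · have hprod : (volume.restrict (W i) : Measure (ℝ × (EuclideanSpace ℝ (Fin 3)))) =
        ((volume : Measure ℝ).restrict (Ioo ((c i).1 - ρ i) ((c i).1 + ρ i))).prod
          ((volume : Measure (EuclideanSpace ℝ (Fin 3))).restrict (ball (c i).2 (ρ i))) :=
      volume_restrict_cylinder_eq_prod _ _ _
    have hae2 : ∀ᵐ t ∂((volume : Measure ℝ).restrict (Ioo ((c i).1 - ρ i) ((c i).1 + ρ i))),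
        ∀ᵐ x ∂((volume : Measure (EuclideanSpace ℝ (Fin 3))).restrict (ball (c i).2 (ρ i))),
          u t x = w t x := by
      rw [hprod] at hae
      exact Measure.ae_ae_of_ae_prod hae
    filter_upwards [hwE, hae2] with t ht hte
    calc ∫⁻ x in ball (c i).2 (ρ i), ‖u t x‖ₑ ^ 2 = ∫⁻ x in ball (c i).2 (ρ i), ‖w t x‖ₑ ^ 2 :=
          lintegral_congr_ae (hte.mono fun x hx => by simp only [hx])
      _ ≤ C i := ht
  · refine hws.congr fun k => lintegral_congr_ae ?_
    filter_upwards [hae] with z hz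
    have hz' : u z.1 z.2 = w z.1 z.2 := hz
    rw [hz']

end Velocity

/-! ### Step 3: the exhaustion `Sₙ = ⋃_{i ≤ n} B(cᵢ, rᵢ)`, `L^{10/3}` bounds and `L²`/`L³` convergence -/

section Exhaustion

/-- **The exhaustion by finite unions of inner balls** (topology and measure): the sets
`Sₙ = ⋃_{i ≤ n} B(cᵢ, rᵢ)` are open, increasing, of finite measure, contained in the compact sets
`⋃_{i ≤ n} B̄(cᵢ, rᵢ) ⊆ O`, and every compact subset of `O` lies in some `Sₙ`. [folklore] -/
theorem exhaustion_of_double_ball_cover {O : Set (ℝ × EuclideanSpace ℝ (Fin 3))}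
    (c : ℕ → ℝ × EuclideanSpace ℝ (Fin 3)) (r : ℕ → ℝ)
    (hr : ∀ i, 0 < r i) (hcO : ∀ i, closedBall (c i) (2 * r i) ⊆ O)
    (hcov : ∀ z ∈ O, ∃ i, z ∈ ball (c i) (r i))
    (S : ℕ → Set (ℝ × EuclideanSpace ℝ (Fin 3)))
    (hS : ∀ n, S n = ⋃ i ∈ Finset.range (n + 1), ball (c i) (r i)) :
    (∀ n, IsOpen (S n)) ∧ Monotone S ∧
    (∀ n, S n ⊆ ⋃ i ∈ Finset.range (n + 1), closedBall (c i) (r i)) ∧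
    (∀ n, IsCompact (⋃ i ∈ Finset.range (n + 1), closedBall (c i) (r i))) ∧
    (∀ n, (⋃ i ∈ Finset.range (n + 1), closedBall (c i) (r i)) ⊆ O) ∧
    (∀ n, volume (S n) ≠ ⊤) ∧
    ∀ K ⊆ O, IsCompact K → ∃ n, K ⊆ S n := by
  have hSK : ∀ n, S n ⊆ ⋃ i ∈ Finset.range (n + 1), closedBall (c i) (r i) := fun n => by
    rw [hS n]
    intro z hz
    simp only [mem_iUnion] at hz ⊢
    obtain ⟨i, hi, hz⟩ := hz
    exact ⟨i, hi, ball_subset_closedBall hz⟩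
  have hKc : ∀ n, IsCompact (⋃ i ∈ Finset.range (n + 1), closedBall (c i) (r i)) := fun n =>
    (Finset.range (n + 1)).isCompact_biUnion fun i _ => isCompact_closedBall _ _
  have hKO : ∀ n, (⋃ i ∈ Finset.range (n + 1), closedBall (c i) (r i)) ⊆ O := fun n => by
    intro z hz
    simp only [mem_iUnion] at hz
    obtain ⟨i, -, hz⟩ := hz
    refine hcO i (closedBall_subset_closedBall ?_ hz)
    linarith [hr i]
  refine ⟨fun n => ?_, fun n m hnm => ?_, hSK, hKc, hKO, fun n => ?_, fun K hK hKc' => ?_⟩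
  · rw [hS n]
    exact isOpen_biUnion fun i _ => isOpen_ball
  · rw [hS n, hS m]
    intro z hz
    simp only [mem_iUnion, Finset.mem_range] at hz ⊢
    obtain ⟨i, hi, hz⟩ := hz
    exact ⟨i, by omega, hz⟩
  · exact ((measure_mono (hSK n)).trans_lt (hKc n).measure_lt_top).ne
  · obtain ⟨t, ht⟩ := hKc'.elim_finite_subcover (fun i => ball (c i) (r i))
      (fun i => isOpen_ball) fun z hz => mem_iUnion.2 (hcov z (hK hz))
    refine ⟨t.sup id, ?_⟩
    rw [hS]
    intro z hz
    have hz' := ht hz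
    simp only [mem_iUnion, Finset.mem_range] at hz' ⊢
    obtain ⟨i, hi, hzi⟩ := hz'
    have hle : i ≤ t.sup id := Finset.le_sup (f := id) hi
    exact ⟨i, by omega, hzi⟩

variable {O : Opens (ℝ × EuclideanSpace ℝ (Fin 3))}
  {useq : ℕ → ℝ → EuclideanSpace ℝ (Fin 3) → EuclideanSpace ℝ (Fin 3)}
  {pseq : ℕ → ℝ → EuclideanSpace ℝ (Fin 3) → ℝ}
  {G : ℕ → ℝ → EuclideanSpace ℝ (Fin 3) → EuclideanSpace ℝ (Fin 3) →L[ℝ] EuclideanSpace ℝ (Fin 3)}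

set_option maxHeartbeats 800000 in
/-- **The velocities on the exhaustion**: with the subsequence and the limit `u` of
`exists_strictMono_velocity_limit` on the outer cylinders `B(cᵢ, 2rᵢ)`, on every
`Sₙ = ⋃_{i ≤ n} B(cᵢ, rᵢ)` the limit is measurable with slices of bounded energy, the `u^k` and
`u` are uniformly bounded in `L^{10/3}(Sₙ)` (the scale-invariant multiplicative inequality on the
parabolic cylinders covering the compact `B̄(cᵢ, rᵢ) ⊆ B(cᵢ, 2rᵢ)`,
`exists_forall_setLIntegral_tenThirds_le_of_isCompact`, and Fatou), and `u^{φ(k)} → u` in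
`L²(Sₙ)` (Bradshaw–Tsai 2019, §4.3, "hence also in `L^{10/3}`"; Lin 1998, Thm. 2.2).
[cite: Lin1998, Thm. 2.2] -/
theorem velocity_limit_on_exhaustion
    (hsuit : ∀ k, IsSuitableWeakSolutionOn O 1 0 (useq k) (pseq k))
    (c : ℕ → ℝ × (EuclideanSpace ℝ (Fin 3))) (r : ℕ → ℝ) (hr : ∀ i, 0 < r i)
    (hcO : ∀ i, closedBall (c i) (2 * r i) ⊆ (O : Set (ℝ × (EuclideanSpace ℝ (Fin 3)))))
    (S : ℕ → Set (ℝ × EuclideanSpace ℝ (Fin 3)))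
    (hS : ∀ n, S n = ⋃ i ∈ Finset.range (n + 1), ball (c i) (r i))
    {φ : ℕ → ℕ} {u : ℝ → (EuclideanSpace ℝ (Fin 3)) → (EuclideanSpace ℝ (Fin 3))}
    (hvel : ∀ i,
      AEStronglyMeasurable (uncurry u)
        (volume.restrict (Ioo ((c i).1 - 2 * r i) ((c i).1 + 2 * r i) ×ˢ
          ball (c i).2 (2 * r i))) ∧
      (∃ C : ℝ≥0,
        (∀ k, ∀ᵐ t ∂((volume : Measure ℝ).restrict
            (Ioo ((c i).1 - 2 * r i) ((c i).1 + 2 * r i))),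
          ∫⁻ x in ball (c i).2 (2 * r i), ‖useq k t x‖ₑ ^ 2 ≤ C) ∧
        (∀ k, HasWeakSpatialGradientOn
          (timeCylinder (⟨ball (c i).2 (2 * r i), isOpen_ball⟩ : Opens (EuclideanSpace ℝ (Fin 3)))
            ((c i).1 - 2 * r i) ((c i).1 + 2 * r i)) (useq k) (G k)) ∧
        (∀ k, ∫⁻ z in Ioo ((c i).1 - 2 * r i) ((c i).1 + 2 * r i) ×ˢ ball (c i).2 (2 * r i),
          ENNReal.ofReal (frobeniusNormSq (G k z.1 z.2)) ≤ C) ∧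
        ∀ᵐ t ∂((volume : Measure ℝ).restrict (Ioo ((c i).1 - 2 * r i) ((c i).1 + 2 * r i))),
          ∫⁻ x in ball (c i).2 (2 * r i), ‖u t x‖ₑ ^ 2 ≤ C) ∧
      Tendsto (fun k => ∫⁻ z in Ioo ((c i).1 - 2 * r i) ((c i).1 + 2 * r i) ×ˢ
          ball (c i).2 (2 * r i), ‖useq (φ k) z.1 z.2 - u z.1 z.2‖ₑ ^ 2) atTop (𝓝 0))
    (n : ℕ) :
    AEStronglyMeasurable (uncurry u) (volume.restrict (S n)) ∧
    (∃ M : ℝ≥0∞, M ≠ ⊤ ∧ (∀ k, ∫⁻ z in S n, ‖useq k z.1 z.2‖ₑ ^ (10 / 3 : ℝ) ≤ M) ∧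
      ∫⁻ z in S n, ‖u z.1 z.2‖ₑ ^ (10 / 3 : ℝ) ≤ M) ∧
    Tendsto (fun k => ∫⁻ z in S n, ‖useq (φ k) z.1 z.2 - u z.1 z.2‖ₑ ^ 2) atTop (𝓝 0) ∧
    ∃ C : ℝ≥0, ∀ᵐ t : ℝ,
      ∫⁻ x, (S n).indicator (fun z : ℝ × EuclideanSpace ℝ (Fin 3) => ‖u z.1 z.2‖ₑ ^ 2) (t, x) ≤
        C := by
  -- the outer cylinders
  set W : ℕ → Set (ℝ × (EuclideanSpace ℝ (Fin 3))) := fun i =>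
    Ioo ((c i).1 - 2 * r i) ((c i).1 + 2 * r i) ×ˢ ball (c i).2 (2 * r i) with hW
  have hWb : ∀ i, W i = ball (c i) (2 * r i) := fun i => by
    rw [hW]
    dsimp only
    have h := Ioo_prod_ball_eq_ball (c i) (2 * r i)
    exact h
  have hWO : ∀ i, W i ⊆ (O : Set (ℝ × (EuclideanSpace ℝ (Fin 3)))) := fun i => by
    rw [hWb]; exact ball_subset_closedBall.trans (hcO i)
  have hKW : ∀ i, closedBall (c i) (r i) ⊆ W i := fun i => by
    rw [hWb]; exact closedBall_subset_ball (by linarith [hr i])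
  have hbW : ∀ i, ball (c i) (r i) ⊆ W i := fun i => by
    rw [hWb]; exact ball_subset_ball (by linarith [hr i])
  have hSW : S n ⊆ ⋃ i ∈ Finset.range (n + 1), W i := by
    rw [hS n]
    intro z hz
    simp only [mem_iUnion] at hz ⊢
    obtain ⟨i, hi, hz⟩ := hz
    exact ⟨i, hi, hbW i hz⟩
  have hSK : S n ⊆ ⋃ i ∈ Finset.range (n + 1), closedBall (c i) (r i) := by
    rw [hS n]
    intro z hz
    simp only [mem_iUnion] at hz ⊢
    obtain ⟨i, hi, hz⟩ := hz
    exact ⟨i, hi, ball_subset_closedBall hz⟩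
  have hvm : ∀ i k, AEStronglyMeasurable (uncurry (useq k)) (volume.restrict (W i)) :=
    fun i k => ((hsuit k).distributional.1.mono_set (hWO i)).aestronglyMeasurable
  choose hum hC hL2 using hvel
  choose C hCE hgradW hCG huE using hC
  -- ### measurability of the limit on `Sₙ`
  have humU : AEStronglyMeasurable (uncurry u) (volume.restrict (⋃ i, W i)) :=
    aestronglyMeasurable_iUnion_iff.2 hum
  have hSU : S n ⊆ ⋃ i, W i := hSW.trans (iUnion₂_subset fun i _ => subset_iUnion W i)
  have humS : AEStronglyMeasurable (uncurry u) (volume.restrict (S n)) :=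
    humU.mono_measure (Measure.restrict_mono hSU le_rfl)
  -- ### the `L^{10/3}` bounds
  have h103 : ∀ i, ∃ M : ℝ≥0∞, M ≠ ⊤ ∧
      (∀ k, ∫⁻ z in closedBall (c i) (r i), ‖useq k z.1 z.2‖ₑ ^ (10 / 3 : ℝ) ≤ M) ∧
      ∫⁻ z in closedBall (c i) (r i), ‖u z.1 z.2‖ₑ ^ (10 / 3 : ℝ) ≤ M := by
    intro i
    obtain ⟨M, hMt, hM⟩ := exists_forall_setLIntegral_tenThirds_le_of_isCompact (hgradW i)
      (hCE i) (hCG i) (isCompact_closedBall (c i) (r i)) (hKW i)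
    refine ⟨M, hMt, hM, ?_⟩
    exact setLIntegral_rpow_le_of_tendsto_lintegral_sub_sq (hKW i)
      (V := fun k => useq (φ k)) (fun k => hvm i (φ k)) (hum i) (hL2 i) (10 / 3 : ℝ)
      fun k => hM (φ k)
  choose M hMt hMk hMu using h103
  have hbound : ∀ {F : ℝ × (EuclideanSpace ℝ (Fin 3)) → ℝ≥0∞},
      (∀ i, ∫⁻ z in closedBall (c i) (r i), F z ≤ M i) →
      ∫⁻ z in S n, F z ≤ ∑ i ∈ Finset.range (n + 1), M i := fun {F} hF =>
    calc ∫⁻ z in S n, F z ≤ ∫⁻ z in ⋃ i ∈ Finset.range (n + 1), closedBall (c i) (r i), F z :=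
          lintegral_mono_set hSK
      _ ≤ ∑ i ∈ Finset.range (n + 1), ∫⁻ z in closedBall (c i) (r i), F z :=
          lintegral_biUnion_finset_le_sum _ _ _
      _ ≤ ∑ i ∈ Finset.range (n + 1), M i := Finset.sum_le_sum fun i _ => hF i
  -- ### `L²` convergence on `Sₙ`
  have hL2S : Tendsto (fun k => ∫⁻ z in S n, ‖useq (φ k) z.1 z.2 - u z.1 z.2‖ₑ ^ 2) atTop
      (𝓝 0) := by
    have hle : ∀ k, ∫⁻ z in S n, ‖useq (φ k) z.1 z.2 - u z.1 z.2‖ₑ ^ 2 ≤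
        ∑ i ∈ Finset.range (n + 1), ∫⁻ z in W i, ‖useq (φ k) z.1 z.2 - u z.1 z.2‖ₑ ^ 2 :=
      fun k => (lintegral_mono_set hSW).trans (lintegral_biUnion_finset_le_sum _ _ _)
    have hsum : Tendsto (fun k => ∑ i ∈ Finset.range (n + 1),
        ∫⁻ z in W i, ‖useq (φ k) z.1 z.2 - u z.1 z.2‖ₑ ^ 2) atTop (𝓝 0) := by
      have h := tendsto_finsetSum (Finset.range (n + 1)) (fun i _ => hL2 i)
      rwa [Finset.sum_const_zero] at h
    exact tendsto_of_tendsto_of_tendsto_of_le_of_le tendsto_const_nhds hsum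
      (fun _ => zero_le) hle
  -- ### the energy class of the limit on `Sₙ`
  have hEu : ∃ C' : ℝ≥0, ∀ᵐ t : ℝ,
      ∫⁻ x, (S n).indicator (fun z : ℝ × EuclideanSpace ℝ (Fin 3) => ‖u z.1 z.2‖ₑ ^ 2) (t, x) ≤
        C' := by
    refine ⟨∑ i ∈ Finset.range (n + 1), C i, ?_⟩
    have hall : ∀ᵐ t : ℝ, ∀ i, t ∈ Ioo ((c i).1 - 2 * r i) ((c i).1 + 2 * r i) →
        ∫⁻ x in ball (c i).2 (2 * r i), ‖u t x‖ₑ ^ 2 ≤ C i :=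
      ae_all_iff.2 fun i => (ae_restrict_iff' measurableSet_Ioo).1 (huE i)
    have hSo : IsOpen (S n) := by rw [hS n]; exact isOpen_biUnion fun i _ => isOpen_ball
    filter_upwards [hall] with t ht
    have hmeas : MeasurableSet (Prod.mk t ⁻¹' S n) :=
      hSo.measurableSet.preimage measurable_prodMk_left
    have e : ∀ x, (S n).indicator (fun z : ℝ × (EuclideanSpace ℝ (Fin 3)) => ‖u z.1 z.2‖ₑ ^ 2) (t, x) =
        (Prod.mk t ⁻¹' S n).indicator (fun x => ‖u t x‖ₑ ^ 2) x := fun x => rfl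
    simp_rw [e]
    rw [lintegral_indicator hmeas]
    calc ∫⁻ x in Prod.mk t ⁻¹' S n, ‖u t x‖ₑ ^ 2
        ≤ ∫⁻ x in ⋃ i ∈ Finset.range (n + 1), Prod.mk t ⁻¹' W i, ‖u t x‖ₑ ^ 2 := by
          refine lintegral_mono_set fun x hx => ?_
          have hx' := hSW hx
          simp only [mem_iUnion] at hx' ⊢
          exact hx'
      _ ≤ ∑ i ∈ Finset.range (n + 1), ∫⁻ x in Prod.mk t ⁻¹' W i, ‖u t x‖ₑ ^ 2 :=
          lintegral_biUnion_finset_le_sum _ _ _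
      _ ≤ ∑ i ∈ Finset.range (n + 1), (C i : ℝ≥0∞) := by
          refine Finset.sum_le_sum fun i _ => ?_
          by_cases hti : t ∈ Ioo ((c i).1 - 2 * r i) ((c i).1 + 2 * r i)
          · have hpre : Prod.mk t ⁻¹' W i = ball (c i).2 (2 * r i) := mk_preimage_prod_right hti
            rw [hpre]
            exact ht i hti
          · have hpre : Prod.mk t ⁻¹' W i = ∅ := mk_preimage_prod_right_eq_empty hti
            rw [hpre, Measure.restrict_empty, lintegral_zero_measure]
            exact zero_le
      _ = ((∑ i ∈ Finset.range (n + 1), C i : ℝ≥0) : ℝ≥0∞) := (ENNReal.ofNNReal_finsetSum _ _).symm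
  refine ⟨humS, ⟨∑ i ∈ Finset.range (n + 1), M i, ENNReal.sum_ne_top.2 fun i _ => hMt i,
    fun k => hbound fun i => hMk i k, hbound hMu⟩, hL2S, hEu⟩

end Exhaustion

/-! ### Step 4: pressures and gradients on the exhaustion (second diagonal extraction, gluing) -/

section Pressure

variable {O : Opens (ℝ × EuclideanSpace ℝ (Fin 3))}
  {useq : ℕ → ℝ → EuclideanSpace ℝ (Fin 3) → EuclideanSpace ℝ (Fin 3)}
  {pseq : ℕ → ℝ → EuclideanSpace ℝ (Fin 3) → ℝ}
  {G : ℕ → ℝ → EuclideanSpace ℝ (Fin 3) → EuclideanSpace ℝ (Fin 3) →L[ℝ] EuclideanSpace ℝ (Fin 3)}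

/-- `∫_S f · 𝟙_A g = ∫_{S ∩ A} f g` (the test functions of the gluing and localisation
arguments). [folklore] -/
theorem setIntegral_mul_indicator_eq {S A : Set (ℝ × (EuclideanSpace ℝ (Fin 3)))} (hA : MeasurableSet A)
    (f g : ℝ × (EuclideanSpace ℝ (Fin 3)) → ℝ) :
    ∫ z in S, f z * A.indicator g z = ∫ z in S ∩ A, f z * g z := by
  have e : (fun z => f z * A.indicator g z) = A.indicator (fun z => f z * g z) := by
    funext z
    by_cases hz : z ∈ A
    · rw [indicator_of_mem hz, indicator_of_mem hz]
    · rw [indicator_of_notMem hz, indicator_of_notMem hz, mul_zero]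
  rw [e, setIntegral_indicator hA]

set_option maxHeartbeats 1600000 in
/-- **Weak limits of the pressures and of the gradients on the exhaustion, one subsequence for
all `Sₙ`.** Along a further subsequence `ψ`: on every `Sₙ` the pressures `p^{φψ(k)}` converge
weakly in `L^{3/2}(Sₙ)` (tested against `L³(Sₙ)`) to one function `p` (weak sequential
compactness of bounded sequences in `L^{3/2}` of a finite measure,
`FunctionSpaces.exists_subseq_tendsto_integral_mul_of_lintegral_rpow_le'`; the limits on the
increasing `Sₙ` are a.e. compatible, weak limits being unique, and are glued by
`FunctionSpaces.exists_glue_of_ae_eq`), with the uniform `L^{3/2}(Sₙ)` bound passing to the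
limit; and the weak gradients `∇u^{φψ(k)}` converge weakly in `L²(Sₙ)` to a weak spatial gradient
of the velocity limit `u` on `Sₙ` (`exists_subseq_weakGradient_weakLimit`). Cantor's diagonal
procedure over `n`. (Lin 1998, Thm. 2.2; Bradshaw–Tsai 2019, §4.3: "`πₖ` … converges weakly to
… `π ∈ L^{3/2}`", "in the weak topology on `L²(0,T;H¹)`".) [cite: Lin1998, Thm. 2.2] -/
theorem exists_strictMono_pressure_gradient_limits
    (hsuit : ∀ k, IsSuitableWeakSolutionOn O 1 0 (useq k) (pseq k))
    (hGw : ∀ k, HasWeakSpatialGradientOn O (useq k) (G k))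
    (hGb : ∀ K ⊆ (O : Set (ℝ × (EuclideanSpace ℝ (Fin 3)))), IsCompact K → ∃ C : ℝ≥0, ∀ k,
      ∫⁻ z in K, ENNReal.ofReal (frobeniusNormSq (G k z.1 z.2)) ≤ C)
    (hP : ∀ K ⊆ (O : Set (ℝ × (EuclideanSpace ℝ (Fin 3)))), IsCompact K → ∃ C : ℝ≥0, ∀ k,
      ∫⁻ z in K, ‖pseq k z.1 z.2‖ₑ ^ (3 / 2 : ℝ) ≤ C)
    (S : ℕ → Set (ℝ × (EuclideanSpace ℝ (Fin 3)))) (hSo : ∀ n, IsOpen (S n)) (hSmono : Monotone S)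
    (hSfin : ∀ n, volume (S n) ≠ ⊤)
    (hScpt : ∀ n, ∃ K : Set (ℝ × EuclideanSpace ℝ (Fin 3)), IsCompact K ∧ S n ⊆ K ∧
      K ⊆ (O : Set (ℝ × EuclideanSpace ℝ (Fin 3))))
    {φ : ℕ → ℕ} {u : ℝ → (EuclideanSpace ℝ (Fin 3)) → (EuclideanSpace ℝ (Fin 3))}
    (humS : ∀ n, AEStronglyMeasurable (uncurry u) (volume.restrict (S n)))
    (hM : ∀ n, ∃ M : ℝ≥0∞, M ≠ ⊤ ∧
      (∀ k, ∫⁻ z in S n, ‖useq k z.1 z.2‖ₑ ^ (10 / 3 : ℝ) ≤ M) ∧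
      ∫⁻ z in S n, ‖u z.1 z.2‖ₑ ^ (10 / 3 : ℝ) ≤ M)
    (hL2S : ∀ n, Tendsto (fun k => ∫⁻ z in S n, ‖useq (φ k) z.1 z.2 - u z.1 z.2‖ₑ ^ 2) atTop
      (𝓝 0)) :
    ∃ (ψ : ℕ → ℕ) (p : ℝ → (EuclideanSpace ℝ (Fin 3)) → ℝ), StrictMono ψ ∧ ∀ n,
      ∃ (Cp : ℝ≥0)
        (Gu : ℝ → EuclideanSpace ℝ (Fin 3) → EuclideanSpace ℝ (Fin 3) →L[ℝ] EuclideanSpace ℝ (Fin 3)),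
        (∀ k, ∫⁻ z in S n, ‖pseq k z.1 z.2‖ₑ ^ (3 / 2 : ℝ) ≤ Cp) ∧
        AEStronglyMeasurable (uncurry p) (volume.restrict (S n)) ∧
        ∫⁻ z in S n, ‖p z.1 z.2‖ₑ ^ (3 / 2 : ℝ) ≤ Cp ∧
        (∀ g : ℝ × (EuclideanSpace ℝ (Fin 3)) → ℝ, MemLp g 3 (volume.restrict (S n)) →
          Tendsto (fun k => ∫ z in S n, pseq (φ (ψ k)) z.1 z.2 * g z) atTop
            (𝓝 (∫ z in S n, p z.1 z.2 * g z))) ∧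
        HasWeakSpatialGradientOn (⟨S n, hSo n⟩ : Opens (ℝ × (EuclideanSpace ℝ (Fin 3)))) u Gu ∧
        ∫⁻ z in S n, ENNReal.ofReal (frobeniusNormSq (Gu z.1 z.2)) < ⊤ ∧
        ∀ (a : EuclideanSpace ℝ (Fin 3))
          (h : ℝ × EuclideanSpace ℝ (Fin 3) → EuclideanSpace ℝ (Fin 3)),
          MemLp h 2 (volume.restrict (S n)) →
          Tendsto (fun k => ∫ z in S n, ⟪G (φ (ψ k)) z.1 z.2 a, h z⟫) atTop
            (𝓝 (∫ z in S n, ⟪Gu z.1 z.2 a, h z⟫)) := by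
  classical
  have hSO : ∀ n, S n ⊆ (O : Set (ℝ × (EuclideanSpace ℝ (Fin 3)))) := fun n => by
    obtain ⟨K, -, hSK, hKO⟩ := hScpt n
    exact hSK.trans hKO
  have hle : ∀ n, ((⟨S n, hSo n⟩ : Opens (ℝ × (EuclideanSpace ℝ (Fin 3))))) ≤ O := fun n z hz => hSO n hz
  have hfin : ∀ n, IsFiniteMeasure
      (volume.restrict (S n) : Measure (ℝ × EuclideanSpace ℝ (Fin 3))) := fun n =>
    ⟨by rw [Measure.restrict_apply_univ]; exact (hSfin n).lt_top⟩
  -- ### the uniform bounds on `Sₙ`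
  have hCp' : ∀ n, ∃ Cp : ℝ≥0, ∀ k, ∫⁻ z in S n, ‖pseq k z.1 z.2‖ₑ ^ (3 / 2 : ℝ) ≤ Cp := by
    intro n
    obtain ⟨K, hKc, hSK, hKO⟩ := hScpt n
    obtain ⟨C, hC⟩ := hP K hKO hKc
    exact ⟨C, fun k => (lintegral_mono_set hSK).trans (hC k)⟩
  choose Cp hCp using hCp'
  have hCg' : ∀ n, ∃ Cg : ℝ≥0, ∀ k,
      ∫⁻ z in S n, ENNReal.ofReal (frobeniusNormSq (G k z.1 z.2)) ≤ Cg := by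
    intro n
    obtain ⟨K, hKc, hSK, hKO⟩ := hScpt n
    obtain ⟨C, hC⟩ := hGb K hKO hKc
    exact ⟨C, fun k => (lintegral_mono_set hSK).trans (hC k)⟩
  choose Cg hCg using hCg'
  have hπm : ∀ n k, AEStronglyMeasurable (uncurry (pseq k)) (volume.restrict (S n)) :=
    fun n k => ((hsuit k).distributional.2.2.1.mono_set (hSO n)).aestronglyMeasurable
  have hvm : ∀ n k, AEStronglyMeasurable (uncurry (useq k)) (volume.restrict (S n)) :=
    fun n k => ((hsuit k).distributional.1.mono_set (hSO n)).aestronglyMeasurable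
  choose M hMt hMk hMu using hM
  have hv3 : ∀ n k, MemLp (uncurry (useq k)) 3 (volume.restrict (S n)) := fun n k => by
    haveI := hfin n
    exact FunctionSpaces.memLp_three_of_lintegral_tenThirds_le (hvm n k) (hMt n) (hMk n k)
  have hu3 : ∀ n, MemLp (uncurry u) 3 (volume.restrict (S n)) := fun n => by
    haveI := hfin n
    exact FunctionSpaces.memLp_three_of_lintegral_tenThirds_le (humS n) (hMt n) (hMu n)
  have h23 : (2 : ℝ≥0∞) ≤ 3 := by norm_num
  have e3 : ENNReal.ofReal 3 = 3 := ENNReal.ofReal_ofNat 3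
  have hpq : (3 / 2 : ℝ).HolderConjugate 3 :=
    Real.holderConjugate_iff.2 ⟨by norm_num, by norm_num⟩
  -- ### the extracted property on `Sₙ`
  set P : ℕ → (ℕ → ℕ) → Prop := fun n ψ =>
    (∃ q : ℝ × (EuclideanSpace ℝ (Fin 3)) → ℝ, MemLp q (ENNReal.ofReal (3 / 2)) (volume.restrict (S n)) ∧
      ∫⁻ z in S n, ‖q z‖ₑ ^ (3 / 2 : ℝ) ≤ Cp n ∧
      ∀ g : ℝ × (EuclideanSpace ℝ (Fin 3)) → ℝ, MemLp g 3 (volume.restrict (S n)) →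
        Tendsto (fun k => ∫ z in S n, uncurry (pseq (φ (ψ k))) z * g z) atTop
          (𝓝 (∫ z in S n, q z * g z))) ∧
    ∃ Gu : ℝ → EuclideanSpace ℝ (Fin 3) → EuclideanSpace ℝ (Fin 3) →L[ℝ] EuclideanSpace ℝ (Fin 3),
      HasWeakSpatialGradientOn (⟨S n, hSo n⟩ : Opens (ℝ × EuclideanSpace ℝ (Fin 3))) u Gu ∧
      ∫⁻ z in S n, ENNReal.ofReal (frobeniusNormSq (Gu z.1 z.2)) ≤ Cg n ∧
      ∀ (a : EuclideanSpace ℝ (Fin 3)) (h : ℝ × EuclideanSpace ℝ (Fin 3) → EuclideanSpace ℝ (Fin 3)),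
        MemLp h 2 (volume.restrict (S n)) →
        Tendsto (fun k => ∫ z in S n, ⟪G (φ (ψ k)) z.1 z.2 a, h z⟫) atTop
          (𝓝 (∫ z in S n, ⟪Gu z.1 z.2 a, h z⟫)) with hP_def
  have hsub : ∀ n (ψ ψ' : ℕ → ℕ),
      (∃ τ : ℕ → ℕ, StrictMono τ ∧ ∀ᶠ k in atTop, ψ' k = ψ (τ k)) → P n ψ → P n ψ' := by
    rintro n ψ ψ' ⟨τ, hτ, heq⟩ ⟨⟨q, hqmem, hqb, hqw⟩, ⟨Gu, hGu, hGub, hGuw⟩⟩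
    refine ⟨⟨q, hqmem, hqb, fun g hg => ?_⟩, ⟨Gu, hGu, hGub, fun a h hh => ?_⟩⟩
    · exact FunctionSpaces.tendsto_of_eventually_eq_comp
        (a := fun m => ∫ z in S n, uncurry (pseq (φ m)) z * g z) hτ heq (hqw g hg)
    · exact FunctionSpaces.tendsto_of_eventually_eq_comp
        (a := fun m => ∫ z in S n, ⟪G (φ m) z.1 z.2 a, h z⟫) hτ heq (hGuw a h hh)
  have hex : ∀ n (ψ : ℕ → ℕ), StrictMono ψ →
      ∃ ψ' : ℕ → ℕ, StrictMono ψ' ∧ P n (ψ ∘ ψ') := by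
    intro n ψ hψ
    haveI := hfin n
    -- pressures
    obtain ⟨σ₂, hσ₂, q, hqmem, hqb, hqw⟩ :=
      FunctionSpaces.exists_subseq_tendsto_integral_mul_of_lintegral_rpow_le'
        (μ := volume.restrict (S n)) hpq (f := fun j => uncurry (pseq (φ (ψ j))))
        (fun j => hπm n _) (ENNReal.coe_ne_top (r := Cp n)) (fun j => hCp n _)
    -- gradients along `ψ ∘ σ₂`
    have hconv2 : Tendsto (fun j => eLpNorm (uncurry (useq (φ (ψ (σ₂ j)))) - uncurry u) 2
        (volume.restrict (S n))) atTop (𝓝 0) :=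
      (tendsto_eLpNorm_sub_of_tendsto_lintegral_sub_sq (V := fun k => useq (φ k)) (u := u)
        (hL2S n)).comp ((hψ.comp hσ₂).tendsto_atTop)
    obtain ⟨σ₃, Gu, hσ₃, hGu, hGub, hGuw⟩ :=
      exists_subseq_weakGradient_weakLimit
        (Q := (⟨S n, hSo n⟩ : Opens (ℝ × EuclideanSpace ℝ (Fin 3)))) (hSfin n)
        (ENNReal.coe_ne_top (r := Cg n))
        (v := fun j => useq (φ (ψ (σ₂ j)))) (u := u) (G := fun j => G (φ (ψ (σ₂ j))))
        (fun j => (hGw _).mono (hle n)) (fun j => hCg n _)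
        (fun j => (hv3 n _).mono_exponent h23) ((hu3 n).mono_exponent h23) hconv2
    refine ⟨σ₂ ∘ σ₃, hσ₂.comp hσ₃, ⟨q, hqmem, hqb, fun g hg => ?_⟩, ⟨Gu, hGu, hGub, hGuw⟩⟩
    have hg' : MemLp g (ENNReal.ofReal 3) (volume.restrict (S n)) := by rwa [e3]
    exact (hqw g hg').comp hσ₃.tendsto_atTop
  obtain ⟨ψ, hψ, hPψ⟩ := FunctionSpaces.exists_strictMono_forall_of_extraction hsub hex
  choose hq hG using hPψ
  choose q hqmem hqb hqw using hq
  choose Gu hGu hGub hGuw using hG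
  -- ### compatibility of the pressure limits along the exhaustion
  have h1p : (1 : ℝ≥0∞) ≤ ENNReal.ofReal (3 / 2) := ENNReal.one_le_ofReal.2 (by norm_num)
  have hcons : ∀ n m, n ≤ m → ∀ᵐ z ∂(volume.restrict (S n)), q n z = q m z := by
    intro n m hnm
    haveI := hfin n
    haveI := hfin m
    have hqn1 : Integrable (q n) (volume.restrict (S n)) := (hqmem n).integrable h1p
    have hqm1 : Integrable (q m) (volume.restrict (S n)) :=
      ((hqmem m).integrable h1p).mono_measure (Measure.restrict_mono (hSmono hnm) le_rfl)
    refine Integrable.ae_eq_of_forall_setIntegral_eq _ _ hqn1 hqm1 fun A hA _ => ?_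
    have hSnm : MeasurableSet (S n) := (hSo n).measurableSet
    -- the two test functions
    have hgA : MemLp (A.indicator fun _ => (1 : ℝ)) 3 (volume.restrict (S n)) :=
      (memLp_const 1).indicator hA
    have hgA' : MemLp ((A ∩ S n).indicator fun _ => (1 : ℝ)) 3 (volume.restrict (S m)) :=
      (memLp_const 1).indicator (hA.inter hSnm)
    have e1 : ∀ f : ℝ × EuclideanSpace ℝ (Fin 3) → ℝ,
        ∫ z in S n, f z * A.indicator (fun _ => (1 : ℝ)) z =
        ∫ z in A ∩ S n, f z := fun f => by
      rw [setIntegral_mul_indicator_eq hA, inter_comm]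
      simp only [mul_one]
    have e2 : ∀ f : ℝ × EuclideanSpace ℝ (Fin 3) → ℝ,
        ∫ z in S m, f z * (A ∩ S n).indicator (fun _ => (1 : ℝ)) z =
        ∫ z in A ∩ S n, f z := fun f => by
      rw [setIntegral_mul_indicator_eq (hA.inter hSnm)]
      simp only [mul_one]
      rw [← inter_assoc, inter_comm (S m) A, inter_assoc, inter_eq_right.2 (hSmono hnm)]
    have hl1 := hqw n _ hgA
    have hl2 := hqw m _ hgA'
    simp_rw [e1] at hl1
    simp_rw [e2] at hl2
    have heq := tendsto_nhds_unique hl1 hl2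
    rw [Measure.restrict_restrict hA]
    exact heq
  -- ### gluing
  set N : ℝ × EuclideanSpace ℝ (Fin 3) → ℕ := fun z =>
    if h : ∃ n, z ∈ S n then Nat.find h else 0 with hN
  have hNS : ∀ z ∈ ⋃ n, S n, z ∈ S (N z) := by
    intro z hz
    have h : ∃ n, z ∈ S n := mem_iUnion.1 hz
    rw [hN]
    dsimp only
    rw [dif_pos h]
    exact Nat.find_spec h
  have hNle : ∀ n, ∀ z ∈ S n, N z ≤ n := by
    intro n z hz
    have h : ∃ n, z ∈ S n := ⟨n, hz⟩
    rw [hN]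
    dsimp only
    rw [dif_pos h]
    exact Nat.find_min' h hz
  obtain ⟨P₀, hP₀, -⟩ := FunctionSpaces.exists_glue_of_ae_eq
    (μ := (volume : Measure (ℝ × EuclideanSpace ℝ (Fin 3))))
    (fun n => (hSo n).measurableSet) N hNS hNle q hcons
  refine ⟨ψ, fun t x => P₀ (t, x), hψ, fun n => ⟨Cp n, Gu n, hCp n, ?_, ?_, fun g hg => ?_,
    hGu n, (hGub n).trans_lt ENNReal.coe_lt_top, hGuw n⟩⟩
  · exact (hqmem n).1.congr ((hP₀ n).mono fun z hz => hz.symm)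
  · calc ∫⁻ z in S n, ‖P₀ (z.1, z.2)‖ₑ ^ (3 / 2 : ℝ)
        = ∫⁻ z in S n, ‖q n z‖ₑ ^ (3 / 2 : ℝ) :=
          lintegral_congr_ae ((hP₀ n).mono fun z hz => by simp only [Prod.mk.eta, hz])
      _ ≤ Cp n := hqb n
  · have e : ∫ z in S n, P₀ (z.1, z.2) * g z = ∫ z in S n, q n z * g z :=
      integral_congr_ae ((hP₀ n).mono fun z hz => by simp only [Prod.mk.eta, hz])
    rw [e]
    exact hqw n g hg

end Pressure

/-! ### Step 5: the discharge -/

section Discharge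

set_option maxHeartbeats 1600000 in
/-- **Rusin–Šverák 2011, Prop. 2.2 (= Jia–Šverák 2013, Lemma 5; Lin 1998, Thm. 2.2): compactness
of suitable weak solutions — proof of the named fact `rusin_sverak_2011_proposition_2_2`.**
"Let `(u^k, p^k)` be a sequence of suitable weak solutions such that `u^k` are uniformly bounded
in the energy space on compact subsets of open set `𝒪` and `p^k` are uniformly bounded in
`L^{3/2}` on compact subsets of `𝒪`. Then the sequence `u^k` is compact in `L³` on compact subsets
of `𝒪`. Moreover, if `u^k → u` in `L³` and `p^k ⇀ p` in `L^{3/2}` on compact subsets of `𝒪`,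
then `(u, p)` is again a suitable weak solution." See the module docstring for the five steps
(cover by double cylinders, Aubin–Lions on each cylinder with one diagonal subsequence, `L^{10/3}`
bounds and `L³` convergence on the exhaustion, weak limits of pressures and gradients with a
second diagonal subsequence and gluing, stability of suitability and exhaustion).
[cite: RusinSverak2011, Prop. 2.2 (arXiv:0911.0500 p. 4)] [cite: JiaSverak2013, Lemma 5] [cite: Lin1998, Thm. 2.2] -/
theorem rusin_sverak_2011_proposition_2_2_holds : rusin_sverak_2011_proposition_2_2 := by
  intro O useq pseq hsuit hE hG hP
  obtain ⟨G, hGw, hGb⟩ := hG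
  rcases (O : Set (ℝ × (EuclideanSpace ℝ (Fin 3)))).eq_empty_or_nonempty with hO | hne
  · -- ### the empty open set: the whole sequence, the zero limit
    have hK0 : ∀ K ⊆ (O : Set (ℝ × (EuclideanSpace ℝ (Fin 3)))), K = ∅ := fun K hK => subset_eq_empty hK hO
    refine ⟨id, 0, 0, strictMono_id, ?_, isSuitableWeakSolutionOn_zero O 1⟩
    exact
      { suitable := fun k => hsuit k
        energy_bound := fun K hK hKc => hE K hK hKc
        gradient_bound := ⟨G, fun k => hGw k, hGb⟩
        pressure_bound := fun K hK hKc => hP K hK hKc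
        tendsto_lintegral := fun K hK _ => by
          rw [hK0 K hK]
          simp only [Measure.restrict_empty, lintegral_zero_measure]
          exact tendsto_const_nhds
        tendsto_integral_pressure := fun K hK _ ψ _ => by
          rw [hK0 K hK]
          simp only [Measure.restrict_empty, integral_zero_measure]
          exact tendsto_const_nhds }
  -- ### Step 1: the cover and the exhaustion
  obtain ⟨c, r, hr, hcO, hcov⟩ := exists_seq_double_ball_cover O.isOpen hne
  set S : ℕ → Set (ℝ × EuclideanSpace ℝ (Fin 3)) := fun n =>
    ⋃ i ∈ Finset.range (n + 1), ball (c i) (r i) with hS_def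
  obtain ⟨hSo, hSmono, hSK, hKc, hKO, hSfin, hScov⟩ :=
    exhaustion_of_double_ball_cover c r hr hcO hcov S (fun n => rfl)
  have hSO : ∀ n, S n ⊆ (O : Set (ℝ × (EuclideanSpace ℝ (Fin 3)))) := fun n => (hSK n).trans (hKO n)
  have hle : ∀ n, ((⟨S n, hSo n⟩ : Opens (ℝ × (EuclideanSpace ℝ (Fin 3))))) ≤ O := fun n z hz => hSO n hz
  have hScpt : ∀ n, ∃ K : Set (ℝ × EuclideanSpace ℝ (Fin 3)), IsCompact K ∧ S n ⊆ K ∧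
      K ⊆ (O : Set (ℝ × EuclideanSpace ℝ (Fin 3))) :=
    fun n => ⟨_, hKc n, hSK n, hKO n⟩
  have hfin : ∀ n, IsFiniteMeasure
      (volume.restrict (S n) : Measure (ℝ × EuclideanSpace ℝ (Fin 3))) := fun n =>
    ⟨by rw [Measure.restrict_apply_univ]; exact (hSfin n).lt_top⟩
  have hvmS : ∀ n k, AEStronglyMeasurable (uncurry (useq k)) (volume.restrict (S n)) :=
    fun n k => ((hsuit k).distributional.1.mono_set (hSO n)).aestronglyMeasurable
  -- ### Step 2: the velocities on the outer cylinders
  obtain ⟨φ, u, hφ, hvel⟩ :=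
    exists_strictMono_velocity_limit hsuit hE hGw hGb hP c (fun i => 2 * r i) hcO
  -- ### Step 3: the velocities on the exhaustion
  have h3 := fun n => velocity_limit_on_exhaustion hsuit c r hr hcO S (fun n => rfl) hvel n
  choose humS hM hL2S hEu using h3
  -- ### Step 4: pressures and gradients
  obtain ⟨ψ, p, hψ, hlim⟩ := exists_strictMono_pressure_gradient_limits hsuit hGw hGb hP S hSo
    hSmono hSfin hScpt humS hM hL2S
  -- ### `L³` on the exhaustion
  choose M hMt hMk hMu using hM
  have hv3 : ∀ n k, MemLp (uncurry (useq k)) 3 (volume.restrict (S n)) := fun n k => by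
    haveI := hfin n
    exact FunctionSpaces.memLp_three_of_lintegral_tenThirds_le (hvmS n k) (hMt n) (hMk n k)
  have hu3 : ∀ n, MemLp (uncurry u) 3 (volume.restrict (S n)) := fun n => by
    haveI := hfin n
    exact FunctionSpaces.memLp_three_of_lintegral_tenThirds_le (humS n) (hMt n) (hMu n)
  have hL3S : ∀ n, Tendsto (fun k => ∫⁻ z in S n, ‖useq (φ k) z.1 z.2 - u z.1 z.2‖ₑ ^ (3 : ℝ))
      atTop (𝓝 0) := fun n =>
    FunctionSpaces.tendsto_lintegral_enorm_rpow_three_of_sq_of_tenThirds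
      (μ := volume.restrict (S n)) (f := fun k => uncurry (useq (φ k))) (g := uncurry u)
      (fun k => hvmS n (φ k)) (humS n) (hL2S n) (hMt n) (fun k => hMk n (φ k))
  have hL3S' : ∀ n, Tendsto (fun k => eLpNorm (uncurry (useq (φ k)) - uncurry u) 3
      (volume.restrict (S n))) atTop (𝓝 0) := fun n =>
    FunctionSpaces.tendsto_eLpNorm_three_of_sq_of_tenThirds
      (μ := volume.restrict (S n)) (f := fun k => uncurry (useq (φ k))) (g := uncurry u)
      (fun k => hvmS n (φ k)) (humS n) (hL2S n) (hMt n) (fun k => hMk n (φ k))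
  -- ### the conclusion
  refine ⟨φ ∘ ψ, u, p, hφ.comp hψ, ?_, ?_⟩
  · -- ### the situation of Prop. 2.2 along `φ ∘ ψ`
    exact
      { suitable := fun k => hsuit _
        energy_bound := fun K hK hKc' => by
          obtain ⟨C, hC⟩ := hE K hK hKc'
          exact ⟨C, fun k => hC _⟩
        gradient_bound := ⟨fun k => G (φ (ψ k)), fun k => hGw _, fun K hK hKc' => by
          obtain ⟨C, hC⟩ := hGb K hK hKc'
          exact ⟨C, fun k => hC _⟩⟩
        pressure_bound := fun K hK hKc' => by
          obtain ⟨C, hC⟩ := hP K hK hKc'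
          exact ⟨C, fun k => hC _⟩
        tendsto_lintegral := fun K hK hKc' => by
          obtain ⟨n, hKS⟩ := hScov K hK hKc'
          have e : ∀ x : ℝ≥0∞, x ^ (3 : ℕ) = x ^ (3 : ℝ) := fun x => by
            rw [← ENNReal.rpow_natCast]
            norm_num
          simp_rw [e]
          have h := (hL3S n).comp hψ.tendsto_atTop
          refine tendsto_of_tendsto_of_tendsto_of_le_of_le tendsto_const_nhds h
            (fun _ => zero_le) fun k => ?_
          exact lintegral_mono_set hKS
        tendsto_integral_pressure := fun K hK hKc' g hg => by
          obtain ⟨n, hKS⟩ := hScov K hK hKc'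
          obtain ⟨Cp, Gu, -, -, -, hpw, -, -, -⟩ := hlim n
          have hKm : MeasurableSet K := hKc'.isClosed.measurableSet
          have hg' : MemLp (K.indicator g) 3 (volume.restrict (S n)) := by
            rw [memLp_indicator_iff_restrict hKm, Measure.restrict_restrict hKm,
              inter_eq_left.2 hKS]
            exact hg
          have e : ∀ f : ℝ × EuclideanSpace ℝ (Fin 3) → ℝ,
              ∫ z in K, f z * g z = ∫ z in S n, f z * K.indicator g z := fun f => by
              rw [setIntegral_mul_indicator_eq hKm, inter_eq_right.2 hKS]
          have h1 : (fun k => ∫ z in K, pseq ((φ ∘ ψ) k) z.1 z.2 * g z) =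
              fun k => ∫ z in S n, pseq (φ (ψ k)) z.1 z.2 * K.indicator g z :=
            funext fun k => e _
          have h2 : ∫ z in K, p z.1 z.2 * g z = ∫ z in S n, p z.1 z.2 * K.indicator g z := e _
          rw [h1, h2]
          exact hpw _ hg' }
  · -- ### suitability of the limit on `O`, by exhaustion
    refine IsSuitableWeakSolutionOn.of_exhaustion (Q := O)
      (Qn := fun n => (⟨S n, hSo n⟩ : Opens (ℝ × (EuclideanSpace ℝ (Fin 3))))) (fun n => hle n)
      (fun n m hnm => ?_) (fun K hK hKc' => hScov K hK hKc') fun n => ?_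
    · intro z hz
      exact hSmono hnm hz
    · obtain ⟨Cp, Gu, hCpk, hpm, hpb, hpw, hGu, hGu2, hGuw⟩ := hlim n
      obtain ⟨CE, hCE⟩ := hEu n
      haveI := hfin n
      refine isSuitableWeakSolutionOn_of_tendsto
        (Q := (⟨S n, hSo n⟩ : Opens (ℝ × EuclideanSpace ℝ (Fin 3)))) (hSfin n) zero_le_one
        (v := fun k => useq (φ (ψ k))) (π := fun k => pseq (φ (ψ k)))
        (G := fun k => G (φ (ψ k))) (u := u) (p := p) (Gu := Gu) (Cp := Cp) ENNReal.coe_ne_top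
        (fun k => (hsuit _).of_le (hle n)) (fun k => (hGw _).mono (hle n)) (fun k => hv3 n _)
        (fun k => hCpk _) (hu3 n) hpm hpb hGu hGu2 (fun K hK _ => ?_)
        ((hL3S' n).comp hψ.tendsto_atTop) hpw hGuw
      refine ⟨CE, ?_⟩
      filter_upwards [hCE] with t ht
      refine le_trans (lintegral_mono fun x => ?_) ht
      exact indicator_le_indicator_of_subset hK (fun _ => zero_le) _

end Discharge

end Literature.Analysis.FluidPDE

end
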